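import Summits.AtomisticToContinuum.Crystallization.Theorems.PricedLinkCensusStackingHingeOfSupportCore
import Summits.AtomisticToContinuum.Crystallization.Theorems.PricedLinkCensusStackingHingeSimilarStarNormalisationBond
import Summits.AtomisticToContinuum.Crystallization.Theorems.PricedLinkCensusStackingHingeSimilarStarNormalisationPattern

/-!
# Route `PricedLinkCensus`, crux `StackingHinge` (stmt-AtomisticToContinuum-14993), line `Sketch`:
# stub `stub_similarStarNormalisation` (V3), support file V — local consequences of exact similar
# stars in an everywhere-good hard-core set

Let `S ⊆ ℝ³` be `δ`-separated with every point SLP-good and bond-shell-good (the per-point body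
of the support core's hypothesis, verbatim), and suppose every `x ∈ S` carries an EXACT SIMILAR
two-type star: its bonded neighbours `{y ∈ S ∖ x : dist x y ≤ 1.01 nn_x}` (`nn_x = infDist x
(S ∖ {x})`) are EXACTLY `x + T x • A x '' F x` with `A x` a linear isometry, `T x > 0` and
`F x ∈ {refStar a h, a • fccKissingPattern}`.  Then (all at every `x ∈ S`):

* `strut_bounds` — `nn_x ≤ T x ‖v‖ ≤ 1.01 nn_x` for `v ∈ F x`;
* `scale_eq_of_bonded` — SCALE CONSTANCY ALONG BONDS: `T p = T x` for every bonded neighbour `p`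
  of `x` (bond symmetry from the landed local Barlow structure `stub_localBarlowStructure`, then
  `scale_eq_of_bond`);
* `dist_le_of_dist_le_scale` — THE ANNULUS `(1.01 nn_x, 5/4 · T x]` IS EMPTY: a point `q ∈ S ∖ x`
  with `dist x q ≤ 5/4 · T x` is bonded to `x`.  Proof: label `x, q` by sites `z₀, z_q` of the SLP
  pattern at `x` (precision `7 nn/40`, radius `29 nn/10`); `dist z₀ z_q < √3 nn`, so the two sites
  have a common touching site `w` (`exists_common_touching`), which carries a bonded neighbour `p`
  of `x` (`touching_subset_labels`), and `q` is bonded to `p` (`dist_le_of_labels_touch`, single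
  occupancy `stub_singleOccupancy` p137299 over `stub_barlowShellSupport` p137271); now `x − p` and
  `q − p` are two struts of ONE exact star of scale `T p = T x`, whose mutual distances are `a`,
  `ρ` (both bonded lengths at `x`, by the gap) or `> 5/4` (`dist_cases`).

All `[folklore]`.
-/

noncomputable section

namespace Summit.AtomisticToContinuum.Crystallization.Theorems.PricedHcpWindowsSimilarStarNormalisation

open Literature.MathematicalPhysics.StatisticalMechanics Literature.Geometry.DiscreteGeometry
open Summit.AtomisticToContinuum.Crystallization.Theorems.PalmUnimodularRigidity.LayeredLawsSelectHcp
open Summit.AtomisticToContinuum.Crystallization.Theorems.PricedHcpWindowsLocalBarlowStructure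
  (dist_labels_le touching_subset_labels dist_le_of_labels_touch stub_localBarlowStructure)
open Summit.AtomisticToContinuum.Crystallization.Theorems.PricedHcpWindowsSingleOccupancy
  (stub_singleOccupancy)
open Summit.AtomisticToContinuum.Crystallization.Theorems.PricedHcpWindowsBarlowShellSupport
  (stub_barlowShellSupport)

/-! ## Elementary facts on separated sets -/

/-- The nearest-neighbour distance seen from the translate `S − x` at `0` is that of `S` at `x`.
[folklore] -/
theorem infDist_translate (S : Set (EuclideanSpace ℝ (Fin 3))) (x : EuclideanSpace ℝ (Fin 3)) :
    Metric.infDist (0 : EuclideanSpace ℝ (Fin 3))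
        (((fun p : EuclideanSpace ℝ (Fin 3) => p - x) '' S) \ {0}) =
      Metric.infDist x (S \ {x}) := by
  have himage : ((fun p : EuclideanSpace ℝ (Fin 3) => p - x) '' S) \ {0} =
      (fun p : EuclideanSpace ℝ (Fin 3) => p - x) '' (S \ {x}) := by
    ext y
    simp only [Set.mem_sdiff, Set.mem_image, Set.mem_singleton_iff]
    constructor
    · rintro ⟨⟨p, hp, rfl⟩, hne⟩
      exact ⟨p, ⟨hp, fun h => hne (by rw [h, sub_self])⟩, rfl⟩
    · rintro ⟨p, ⟨hp, hpx⟩, rfl⟩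
      exact ⟨⟨p, hp, rfl⟩, fun h => hpx (sub_eq_zero.1 h)⟩
  have hiso : Isometry (fun p : EuclideanSpace ℝ (Fin 3) => p - x) :=
    Isometry.of_dist_eq fun p q => by simp [dist_eq_norm]
  rw [himage, ← Metric.infDist_image hiso (x := x), sub_self]

/-- In a `δ`-separated set the nearest-neighbour distance of a point with a companion is `≥ δ`,
hence positive, and at most the distance to any other point. [folklore] -/
theorem le_infDist_of_sep {S : Set (EuclideanSpace ℝ (Fin 3))} {δ : ℝ}
    (hsep : ∀ x ∈ S, ∀ y ∈ S, x ≠ y → δ ≤ dist x y) {x y : EuclideanSpace ℝ (Fin 3)} (hx : x ∈ S)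
    (hy : y ∈ S) (hyx : y ≠ x) :
    δ ≤ Metric.infDist x (S \ {x}) ∧ Metric.infDist x (S \ {x}) ≤ dist x y := by
  have hy' : y ∈ S \ {x} := ⟨hy, hyx⟩
  exact ⟨(Metric.le_infDist ⟨y, hy'⟩).2 fun z hz => hsep x hx z hz.1 (Ne.symm hz.2),
    Metric.infDist_le_dist_of_mem hy'⟩

/-- `1.7 < √3` and `(a√(2/3))² = ⅔ a²`. [folklore] -/
theorem sqrt_facts (a : ℝ) : 17 / 10 < Real.sqrt 3 ∧ (a * Real.sqrt (2 / 3)) ^ 2 = 2 / 3 * a ^ 2 := by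
  constructor
  · rw [Real.lt_sqrt (by norm_num)]; norm_num
  · rw [mul_pow, Real.sq_sqrt (by norm_num : (0 : ℝ) ≤ 2 / 3)]; ring

/-! ## Local consequences of exact similar stars -/

section Local

variable {a h : ℝ} (ha₁ : 189 / 200 ≤ a) (ha₂ : a ≤ 199 / 200) (hh₁ : 77 / 100 ≤ h)
  (hh₂ : h ≤ 163 / 200) {δ : ℝ} (hδ : 0 < δ) {S : Set (EuclideanSpace ℝ (Fin 3))}
  (hsep : ∀ x ∈ S, ∀ y ∈ S, x ≠ y → δ ≤ dist x y)
  (hgood : ∀ x ∈ S, (∀ t r : ℝ, Metric.infDist x (S \ {x}) / 6 < t → r < 3 * Metric.infDist x (S \ {x}) → ∃ s : ℤ → ℤ, Literature.MathematicalPhysics.StatisticalMechanics.IsHaggSeq s ∧ ∃ g : EuclideanSpace ℝ (Fin 3) ≃ᵃⁱ[ℝ] EuclideanSpace ℝ (Fin 3), (∀ y ∈ S, dist x y ≤ r → ∃ z ∈ Literature.MathematicalPhysics.StatisticalMechanics.barlowStacking (Metric.infDist x (S \ {x})) (Metric.infDist x (S \ {x}) * Real.sqrt (2 / 3)) s, dist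 y (g z) ≤ t) ∧ (∀ z ∈ Literature.MathematicalPhysics.StatisticalMechanics.barlowStacking (Metric.infDist x (S \ {x})) (Metric.infDist x (S \ {x}) * Real.sqrt (2 / 3)) s, dist x (g z) ≤ r → ∃ y ∈ S, dist y (g z) ≤ t)) ∧ ((∀ y ∈ S, y ≠ x → dist x y < 107 / 100 * Metric.infDist x (S \ {x}) → dist x y ≤ 101 / 100 * Metric.infDist x (S \ {x})) ∧ ∃ T : Finset (EuclideanSpace ℝ (Fin 3)), (↑T : Set (EuclideanSpace ℝ (Fin 3))) ⊆ {y : EuclideanSpace ℝ (Fin 3) | y ∈ S ∧ y ≠ x ∧ dist x y ≤ 101 / 100 * Metric.infDist x (S \ {x})} ∧ T.card = 12))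
  {A : EuclideanSpace ℝ (Fin 3) → (EuclideanSpace ℝ (Fin 3) ≃ₗᵢ[ℝ] EuclideanSpace ℝ (Fin 3))}
  {T : EuclideanSpace ℝ (Fin 3) → ℝ}
  {F : EuclideanSpace ℝ (Fin 3) → Set (EuclideanSpace ℝ (Fin 3))}
  (hT : ∀ x ∈ S, 0 < T x)
  (hF : ∀ x ∈ S, F x = (refStar a h : Set (EuclideanSpace ℝ (Fin 3))) ∨
    F x = (fun p : EuclideanSpace ℝ (Fin 3) => a • p) ''
      (fccKissingPattern : Set (EuclideanSpace ℝ (Fin 3))))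
  (hstar : ∀ x ∈ S, {y : EuclideanSpace ℝ (Fin 3) | y ∈ S ∧ y ≠ x ∧
      dist x y ≤ 101 / 100 * Metric.infDist x (S \ {x})} = (fun v => x + T x • A x v) '' F x)
include hT hstar

omit hT in
/-- A strut of the exact star is a bonded neighbour. [folklore] -/
theorem mem_of_strut {x : EuclideanSpace ℝ (Fin 3)} (hx : x ∈ S) {v : EuclideanSpace ℝ (Fin 3)}
    (hv : v ∈ F x) :
    x + T x • A x v ∈ S ∧ x + T x • A x v ≠ x ∧
      dist x (x + T x • A x v) ≤ 101 / 100 * Metric.infDist x (S \ {x}) := by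
  have h : x + T x • A x v ∈ {y : EuclideanSpace ℝ (Fin 3) | y ∈ S ∧ y ≠ x ∧
      dist x y ≤ 101 / 100 * Metric.infDist x (S \ {x})} := by
    rw [hstar x hx]; exact ⟨v, hv, rfl⟩
  exact h

omit hT in
/-- A bonded neighbour is a strut of the exact star. [folklore] -/
theorem exists_strut_of_bonded {x : EuclideanSpace ℝ (Fin 3)} (hx : x ∈ S)
    {y : EuclideanSpace ℝ (Fin 3)} (hy : y ∈ S) (hyx : y ≠ x)
    (hd : dist x y ≤ 101 / 100 * Metric.infDist x (S \ {x})) : ∃ v ∈ F x, x + T x • A x v = y := by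
  have h : y ∈ {y : EuclideanSpace ℝ (Fin 3) | y ∈ S ∧ y ≠ x ∧
      dist x y ≤ 101 / 100 * Metric.infDist x (S \ {x})} := ⟨hy, hyx, hd⟩
  rw [hstar x hx] at h
  exact h

/-- **Strut bounds**: `nn_x ≤ T x ‖v‖ ≤ 1.01 nn_x` for `v ∈ F x`. [folklore] -/
theorem strut_bounds {x : EuclideanSpace ℝ (Fin 3)} (hx : x ∈ S) {v : EuclideanSpace ℝ (Fin 3)}
    (hv : v ∈ F x) :
    Metric.infDist x (S \ {x}) ≤ T x * ‖v‖ ∧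
      T x * ‖v‖ ≤ 101 / 100 * Metric.infDist x (S \ {x}) := by
  obtain ⟨hS, hne, hd⟩ := mem_of_strut hstar hx hv
  rw [dist_self_add_smul_map x (hT x hx).le] at hd
  refine ⟨?_, hd⟩
  have hmem : x + T x • A x v ∈ S \ {x} := ⟨hS, hne⟩
  have := Metric.infDist_le_dist_of_mem (x := x) hmem
  rwa [dist_self_add_smul_map x (hT x hx).le] at this

omit hT hstar in
include hδ hsep hgood in
/-- The nearest-neighbour distance of a point of `S` is positive (a bond-shell neighbour exists and
`S` is `δ`-separated). [folklore] -/
theorem infDist_pos {x : EuclideanSpace ℝ (Fin 3)} (hx : x ∈ S) : 0 < Metric.infDist x (S \ {x}) := by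
  obtain ⟨-, -, Tx, hTx, hTxc⟩ := hgood x hx
  obtain ⟨p, hp⟩ := Finset.card_pos.1 (by rw [hTxc]; norm_num)
  obtain ⟨hpS, hpx, -⟩ := hTx (Finset.mem_coe.2 hp)
  exact hδ.trans_le (le_infDist_of_sep hsep hx hpS hpx).1

include ha₁ ha₂ hh₁ hh₂ hδ hsep hgood hF in
/-- **SCALE CONSTANCY ALONG BONDS**: a bonded neighbour `p` of `x` has `T p = T x` (bond symmetry
from `stub_localBarlowStructure`, the gap at `p`, and `scale_eq_of_bond`). [folklore] -/
theorem scale_eq_of_bonded {x : EuclideanSpace ℝ (Fin 3)} (hx : x ∈ S) {p : EuclideanSpace ℝ (Fin 3)}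
    (hp : p ∈ S) (hpx : p ≠ x) (hd : dist x p ≤ 101 / 100 * Metric.infDist x (S \ {x})) :
    T p = T x := by
  have hLS := stub_localBarlowStructure (stub_singleOccupancy stub_barlowShellSupport) δ hδ S hsep hgood
  have hsymm : dist x p ≤ 101 / 100 * Metric.infDist p (S \ {p}) := (hLS x hx).2.1 p hp hpx hd
  obtain ⟨v, hv, hpv⟩ := exists_strut_of_bonded hstar hx hp hpx hd
  obtain ⟨w, hw, hxw⟩ := exists_strut_of_bonded hstar hp hx hpx.symm (by rwa [dist_comm] at hsymm)
  refine scale_eq_of_bond ha₁ ha₂ hh₁ hh₂ (hF x hx) (hF p hp) (hT x hx) (hT p hp) hv hpv.symm hw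
    hxw.symm (fun u hu => strut_bounds hT hstar hx hu) (fun u hu => (strut_bounds hT hstar hp hu).2) ?_
  intro u hu hzp hlt
  obtain ⟨hzS, -, -⟩ := mem_of_strut hstar hx hu
  have hle : dist p (x + T x • A x u) ≤ 101 / 100 * Metric.infDist p (S \ {p}) :=
    (hgood p hp).2.1 _ hzS hzp hlt
  obtain ⟨u', hu', he⟩ := exists_strut_of_bonded hstar hp hzS hzp hle
  exact ⟨u', hu', he.symm⟩

include ha₁ ha₂ hh₁ hh₂ hδ hsep hgood hF in
/-- **THE ANNULUS IS EMPTY**: a point `q ∈ S ∖ x` with `dist x q ≤ 5/4 · T x` is a bonded neighbour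
of `x` (`dist x q ≤ 1.01 nn_x`).  See the module docstring for the proof. [folklore] -/
theorem dist_le_of_dist_le_scale {x : EuclideanSpace ℝ (Fin 3)} (hx : x ∈ S)
    {q : EuclideanSpace ℝ (Fin 3)} (hq : q ∈ S) (hqx : q ≠ x) (hdq : dist x q ≤ 5 / 4 * T x) :
    dist x q ≤ 101 / 100 * Metric.infDist x (S \ {x}) := by
  by_contra hfar
  push Not at hfar
  have hSO1 := stub_singleOccupancy stub_barlowShellSupport δ hδ S hsep hgood
  have hLS := stub_localBarlowStructure (stub_singleOccupancy stub_barlowShellSupport) δ hδ S hsep hgood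
  set nn := Metric.infDist x (S \ {x}) with hnn_def
  have hnn : 0 < nn := infDist_pos hδ hsep hgood hx
  have ha : 0 < a := by linarith
  have hTx0 := hT x hx
  -- `T x ≤ 1.01 nn / a`, so `dist x q ≤ 1.34 nn`
  obtain ⟨v₁, hv₁, hv₁a⟩ := exists_norm_eq ha₁ (hF x hx)
  have hTx : T x * a ≤ 101 / 100 * nn := by
    have := (strut_bounds hT hstar hx hv₁).2; rwa [hv₁a] at this
  have hdq' : dist x q ≤ 134 / 100 * nn := by nlinarith
  -- the SLP datum at `x`: precision `7 nn / 40`, radius `29 nn / 10`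
  obtain ⟨hslp, hgap, Tx, hTx', hTxc⟩ := hgood x hx
  obtain ⟨s, hs, g, hCL1, hCL2⟩ := hslp (7 / 40 * nn) (29 / 10 * nn) (by linarith) (by linarith)
  have hSO := hSO1 x hx (7 / 40 * nn) (29 / 10 * nn) (by linarith) le_rfl le_rfl s g hs hCL1 hCL2
  obtain ⟨z₀, hz₀, hxz₀⟩ := hCL1 x hx (by rw [dist_self]; positivity)
  obtain ⟨zq, hzq, hqzq⟩ := hCL1 q hq (by linarith)
  obtain ⟨h17, hh23⟩ := sqrt_facts nn
  have hzz : dist z₀ zq < Real.sqrt 3 * nn := by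
    have := dist_labels_le g x q z₀ zq
    nlinarith
  have hne : z₀ ≠ zq := by
    intro heq
    rw [← heq] at hqzq
    exact hqx (hSO z₀ hz₀ (by linarith) q hq x hx hqzq hxz₀)
  -- a common touching site `w` of the two labels carries a bonded neighbour `p` of `x`
  obtain ⟨w, hw, hz₀w, hzqw⟩ := exists_common_touching hs hnn hh23 hz₀ hzq hne hzz
  obtain ⟨p, hpT, hpw⟩ := touching_subset_labels hs hnn le_rfl le_rfl hCL1 hSO hx
    (by rw [dist_self]; positivity) hz₀ hxz₀ (by linarith : nn ≤ 101 / 100 * nn) hTx' hTxc w hw hz₀w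
  obtain ⟨hpS, hpx, hxp⟩ := hTx' (Finset.mem_coe.2 hpT)
  -- `q` is bonded to `p` (exact links, easy direction)
  obtain ⟨-, -, Tp, hTp', hTpc⟩ := hgood p hpS
  have hm : Metric.infDist p (S \ {p}) ≤ 101 / 100 * nn :=
    (le_infDist_of_sep hsep hpS hx hpx.symm).2.trans (by rwa [dist_comm])
  have hzqdeep : dist x (g zq) ≤ 9 / 4 * nn := by
    have := dist_triangle x q (g zq); linarith
  have hqp : dist p q ≤ 101 / 100 * Metric.infDist p (S \ {p}) :=
    dist_le_of_labels_touch hs hnn le_rfl le_rfl hCL1 hSO hpS hxp hw hpw hm hTp' hTpc hq hzq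
      (by rw [dist_comm]; exact hzqw) hzqdeep hqzq
  have hqp' : q ≠ p := by
    rintro rfl
    linarith
  -- `x - p` and `q - p` are two struts of ONE exact star, of scale `T p = T x`
  obtain ⟨f₂, hf₂, hqe⟩ := exists_strut_of_bonded hstar hpS hq hqp' hqp
  have hxp' : dist p x ≤ 101 / 100 * Metric.infDist p (S \ {p}) := by
    rw [dist_comm]; exact (hLS x hx).2.1 p hpS hpx hxp
  obtain ⟨f₁, hf₁, hxe⟩ := exists_strut_of_bonded hstar hpS hx hpx.symm hxp'
  have hTp : T p = T x := scale_eq_of_bonded ha₁ ha₂ hh₁ hh₂ hδ hsep hgood hT hF hstar hx hpS hpx hxp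
  have hf₁₂ : f₁ ≠ f₂ := by
    rintro rfl
    exact hqx (hqe.symm.trans hxe)
  have hdxq : dist x q = T x * dist f₁ f₂ := by
    have := dist_add_smul_map p (hT p hpS).le (A p) f₁ f₂
    rwa [hxe, hqe, hTp] at this
  rcases dist_cases ha₁ hh₁ (hF p hpS) hf₁ hf₂ hf₁₂ with h1 | ⟨h2, hFh⟩ | h3
  · -- a strut of length `T x · a ≤ 1.01 nn`
    rw [h1] at hdxq
    linarith
  · -- a strut of length `T x · ρ < 1.07 nn`: bonded by the gap at `x`
    obtain ⟨f, hf, hfρ⟩ := exists_norm_sq_eq_refStar a h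
    rw [← hFh] at hf
    have hfn : ‖f‖ = dist f₁ f₂ :=
      (pow_left_inj₀ (norm_nonneg _) dist_nonneg two_ne_zero).1 (hfρ.trans h2.symm)
    have h4 := (strut_bounds hT hstar hpS hf).2
    obtain ⟨f', hf', hf'a⟩ := exists_norm_eq ha₁ (hF p hpS)
    have h5 := (strut_bounds hT hstar hpS hf').1
    rw [hf'a, hTp] at h5
    rw [hTp, hfn] at h4
    have hlt : dist x q < 107 / 100 * nn := by
      rw [hdxq]; nlinarith
    have := hgap q hq hqx hlt
    linarith
  · -- a far pair: `dist x q > 5/4 · T x`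
    nlinarith

end Local

end Summit.AtomisticToContinuum.Crystallization.Theorems.PricedHcpWindowsSimilarStarNormalisation

end
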